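import Summits.ResolutionOfSingularities.ResolutionOfSingularities.Theorems.PlanarCurveTrapEngine2
import HarnessLib

/-!
# PlanarCurveTrap — decomp-res node «CurveTrap» (lens-5 g26, critic row 177 CLEARED DECIDED +1), tree file 6/7 of the node

Content VERBATIM from the decomp-res lens-5 g26 node `HOME/decomp-res-lens-5/g26/CurveTrap.lean` (pin 39d382f9;
imports the landed tree only, carries nothing);
HOME = run/shared/lean/pub/decomp-res; critic row 177 CLEARED DECIDED +1; landing orders NODE §8 / INBOX :842 —
provenance, critic text and the lens header in full in the first
file of the node, `PlanarCurveTrapQPow`.  Namespace `…Theorems.CurveTrap`; `--supports stmt-ResolutionOfSingularities-31770`.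

## This file

§I START — `shiftMap`, `start`: a terminal flag at an isolated top point with degrees `≥ q+1` IS a curve form (`∃ a
b, 1 ≤ a ∧ a < q ∧ InCurveForm q ↑G Φ.other Φ.curve a b`); §J THE TRAP ON THE WALK — `false_of_inEndForm`,
`excLetters_secState_succ_ne_empty`, **`noLowEmptyIsolatedSectionTailsDeep_holds :
SectionLift.NoLowEmptyIsolatedSectionTailsDeep`** (PROVED, hypothesis-free: the low-empty class of window row 172
(T-1′) is EMPTY), the node equation **`defectWalksDeep_iff_curveTrap`** (`MaxContactCut.DefectWalksDeep ↔
NoFreePointTailsDeep ∧ (NoNonTerminalSectionPlanarJointTailsDeep ∧ NoLowLiveTerminalSectionPlanarTailsDeep) ∧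
StallVertex.NoPositiveSkewStalledTailsDeep ∧ StallVertex.NoNullFlatSkewStalledTailsDeep`, EXACT, hypothesis-free),
**`terminal_iff_lowLive : NoTerminalSectionPlanarJointTailsDeep ↔ NoLowLiveTerminalSectionPlanarTailsDeep`** (the
g24 terminal leaf IS the low-live class), `closes_curveTrap` / `closes_curveTrap_leaves` (31770 BY NAME given the
leaves).  (This first part carries: `constantCoeff_subst_of_constantCoeff_zero`, `shiftMap`,
`constantCoeff_shiftMap`, `start`, `false_of_inEndForm`, `fin2_cover`, `step_F`, `secPt_idx_eq_zero`,
`excLetters_secState_succ_ne_empty`.)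

[WRITER NOTE (decomp-res writer g11): file split only (tree files ≤ 400 lines); namespace, sections, section
variables, the `open` block and every
declaration exactly as in the lens (the node's global dupNamespace-linter line is dropped — the library sets it);
ONE deletion (gate dedup
rule, critic :842 watch-list): the node's copy `eq_single_add_single_two` is NOT re-landed — it is LITERALLY the landed
`HauserPerlega2024.finsupp_eq_single_add_single` (`PointBlowupFlagTranslatedStep`, imported; namespace opened as in
the lens), cited by name at its two uses; no instance, no notation, no include/omit added.]

(Sources: HauserPerlega2024 (characteristic-free resolution of surfaces by point blowups: Props. 3–4, the monomial
case); Hauser2010 Lectures VII–IX; CossartJannsenSaito2020 Ch. 5; Moh1987; BenitoVillamayor2014; the Hasse–Schmidt /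
point-blowup flag formalism of the tree (Literature PointBlowupFlag*).)
-/

open MvPolynomial Finset
open Literature.AlgebraicGeometry.Resolution
open Literature.AlgebraicGeometry.Resolution.Hauser2010
open Literature.AlgebraicGeometry.Resolution.HauserPerlega2024
open Literature.AlgebraicGeometry.Resolution.PointBlowup
open Literature.AlgebraicGeometry.Resolution.WeightedBlowup
open Summit.ResolutionOfSingularities.ResolutionOfSingularities.Theses
open Summit.ResolutionOfSingularities.ResolutionOfSingularities.Theorems.TightDefectClasses
open Summit.ResolutionOfSingularities.ResolutionOfSingularities.Theorems.TightDefectStrongWalks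
open Summit.ResolutionOfSingularities.ResolutionOfSingularities.Theorems.ItineraryCutClasses
open Summit.ResolutionOfSingularities.ResolutionOfSingularities.Theorems.ProximityCut
open Summit.ResolutionOfSingularities.ResolutionOfSingularities.Theorems.ExitLaw
open Summit.ResolutionOfSingularities.ResolutionOfSingularities.Theorems.PlanarCut
open Summit.ResolutionOfSingularities.ResolutionOfSingularities.Theorems.CoefficientCut
open Summit.ResolutionOfSingularities.ResolutionOfSingularities.Theorems.PlanarPort
open Summit.ResolutionOfSingularities.ResolutionOfSingularities.Theorems.SectionLift

namespace Summit.ResolutionOfSingularities.ResolutionOfSingularities.Theorems.CurveTrap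

section Start

variable {σ : Type} [DecidableEq σ] [Fintype σ] {L : Type} [Field L]

/-! ## §I START — a terminal flag at an isolated top point puts `G` in CURVE FORM

From `IsTerminalGiven q E (Φ.expansion q G)`, `Φ = ⟨c, o, h⟩` well-formed, `IsolatedTop q G` and all monomials of
degree `≥ q + 1`: `↑G = X_o^b · (X_c + h(X_o))^a · U + S_q` with `1 ≤ a < q` (every other terminal shape is a fat
point by ISO-1 / ISO-2, or has a monomial of degree `< q`). -/

omit [DecidableEq σ] [Fintype σ] in
/-- A substitution by series without constant terms keeps constant terms. [folklore] -/
theorem constantCoeff_subst_of_constantCoeff_zero {τ : Type*} {a : σ → MvPowerSeries τ L}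
    (ha : MvPowerSeries.HasSubst a) (ha0 : ∀ l, MvPowerSeries.constantCoeff (a l) = 0) (f : MvPowerSeries σ L) :
    MvPowerSeries.constantCoeff (MvPowerSeries.subst a f) = MvPowerSeries.constantCoeff f := by
  have hf : f = MvPowerSeries.C (MvPowerSeries.constantCoeff f) + (f - MvPowerSeries.C (MvPowerSeries.constantCoeff f)) := by
    ring
  conv_lhs => rw [hf]
  rw [← MvPowerSeries.coe_substAlgHom ha, map_add, MvPowerSeries.coe_substAlgHom ha, MvPowerSeries.subst_C, map_add,
    MvPowerSeries.constantCoeff_C, MvPowerSeries.constantCoeff_subst_eq_zero ha ha0 (by simp), add_zero]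

/-- The shift map `X_c ↦ X_c + φ(X_o)`, `X_l ↦ X_l` (`= substFree o c φ` on polynomials).  DEFINITION (support). -/
noncomputable def shiftMap (o c : σ) (φ : PowerSeries L) : σ → MvPowerSeries σ L := fun l =>
  if l = c then (MvPowerSeries.X c : MvPowerSeries σ L) + PowerSeries.subst (MvPowerSeries.X o : MvPowerSeries σ L) φ
  else MvPowerSeries.X l

omit [Fintype σ] in
/-- [folklore] -/
theorem constantCoeff_shiftMap {o c : σ} {φ : PowerSeries L} (hφ : PowerSeries.constantCoeff φ = 0) (l : σ) :
    MvPowerSeries.constantCoeff (shiftMap o c φ l) = 0 := by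
  classical
  unfold shiftMap
  split_ifs
  · rw [map_add, MvPowerSeries.constantCoeff_X, zero_add, constantCoeff_subst_X_univ o hφ]
  · exact MvPowerSeries.constantCoeff_X l

variable (p : ℕ) [Fact p.Prime] [CharP L p]

/-- **START.** [new] (Sources: HauserPerlega2024, §3 p. 775 (terminal cases); §5 p. 783 (expansion in subordinate
parameters).) -/
theorem start (e : ℕ) {G : MvPolynomial σ L} {E : Finset σ} (Φ : FlagDatum σ L) (hWF : Φ.WF)
    (hσ : ∀ l, l = Φ.other ∨ l = Φ.curve) (hT : IsTerminalGiven (p ^ e) E (Φ.expansion (p ^ e) G))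
    (hiso : IsolatedTop (p ^ e) G) (hdeg : ∀ d ∈ G.support, p ^ e + 1 ≤ d.degree) :
    ∃ a b : ℕ, 1 ≤ a ∧ a < p ^ e ∧ InCurveForm (p ^ e) (G : MvPowerSeries σ L) Φ.other Φ.curve a b := by
  classical
  -- names
  obtain ⟨hco, hh0⟩ := hWF
  set c := Φ.curve with hc
  set o := Φ.other with ho
  set h := Φ.h with hhdef
  have hoc : o ≠ c := fun h' => hco h'.symm
  have hσ' : ∀ l, l = o ∨ l = c := hσ
  have hq0 : p ^ e ≠ 0 := pow_ne_zero e (Fact.out : p.Prime).ne_zero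
  have hq1 : 1 ≤ p ^ e := Nat.one_le_iff_ne_zero.mpr hq0
  -- the two shifts
  have hneg : PowerSeries.constantCoeff (-h) = 0 := by rw [map_neg, hh0, neg_zero]
  have ha₁ : MvPowerSeries.HasSubst (shiftMap (L := L) o c (-h)) := hasSubst_shift o c (-h) hneg
  have ha₂ : MvPowerSeries.HasSubst (shiftMap (L := L) o c h) := hasSubst_shift o c h hh0
  set S := MvPowerSeries.subst (shiftMap o c (-h)) (G : MvPowerSeries σ L) with hS
  have hexp : Φ.expansion (p ^ e) G = cleanSeries (p ^ e) S := rfl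
  rw [hexp] at hT
  set H := cleanSeries (p ^ e) S with hH
  set Pq := S - H with hPq
  have hPqq : IsQPow (p ^ e) Pq := isQPow_sub_cleanSeries (p ^ e) S
  set τ := MvPowerSeries.substAlgHom (R := L) ha₂ with hτ
  have hτe : ∀ f, MvPowerSeries.subst (shiftMap o c h) f = τ f := fun f => by
    rw [hτ, MvPowerSeries.coe_substAlgHom ha₂]
  set hhat := PowerSeries.subst (MvPowerSeries.X o : MvPowerSeries σ L) h with hhhat
  set W₀ := (MvPowerSeries.X c : MvPowerSeries σ L) + hhat with hW₀
  have hτc : τ (MvPowerSeries.X c) = W₀ := by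
    rw [← hτe, MvPowerSeries.subst_X ha₂, shiftMap, if_pos rfl]
  have hτo : τ (MvPowerSeries.X o) = MvPowerSeries.X o := by
    rw [← hτe, MvPowerSeries.subst_X ha₂, shiftMap, if_neg hoc]
  have hτ0 : ∀ u, MvPowerSeries.constantCoeff (τ u) = MvPowerSeries.constantCoeff u := fun u => by
    rw [← hτe]; exact constantCoeff_subst_of_constantCoeff_zero ha₂ (constantCoeff_shiftMap hh0) u
  have hτPq : IsQPow (p ^ e) (τ Pq) := by rw [← hτe]; exact hPqq.subst p ha₂ e
  -- `↑G = τ H + τ Pq`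
  have hGτ : (G : MvPowerSeries σ L) = τ H + τ Pq := by
    have h1 : τ S = (G : MvPowerSeries σ L) := by
      rw [← hτe, hS]
      have h2 := subst_shift_subst_shift o c hoc (-h) h hneg hh0 (G : MvPowerSeries σ L)
      rw [neg_add_cancel] at h2
      exact h2.trans (subst_shift_zero o c _)
    rw [← map_add, hPq, add_sub_cancel, h1]
  -- the curve `W₀ = X_c + h(X_o)`
  have hW₀0 : MvPowerSeries.constantCoeff W₀ = 0 := by
    rw [hW₀, map_add, MvPowerSeries.constantCoeff_X, zero_add, hhhat, constantCoeff_subst_X_univ o hh0]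
  have hW₀c : MvPowerSeries.coeff (Finsupp.single c 1) W₀ ≠ 0 := by
    rw [hW₀, map_add, MvPowerSeries.coeff_X, if_pos rfl, hhhat, coeff_single_subst_X_univ_of_ne hoc h 1 one_ne_zero,
      add_zero]
    exact one_ne_zero
  -- ISO shortcuts
  have hISO1 : ∀ R : MvPowerSeries σ L, (G : MvPowerSeries σ L) ≠ MvPowerSeries.X o ^ p ^ e * R + τ Pq := by
    intro R hR
    exact not_isolatedTop_of_X_pow_form p e (i := o) (j := c) hco hR hτPq hiso
  have hISO2 : ∀ R : MvPowerSeries σ L, (G : MvPowerSeries σ L) ≠ W₀ ^ p ^ e * R + τ Pq := by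
    intro R hR
    exact not_isolatedTop_of_curve_pow p e hco hh0 (R := R) (by rw [hR]) hτPq hiso
  rcases hT with ⟨μ, u, hHμ, hu, hndvd, -⟩ | ⟨y, k', g, hk', hHy, -, -⟩
  · -- MONOMIAL CASE `H = x^μ · u`
    have hmono : MvPowerSeries.monomial μ (1 : L) = MvPowerSeries.X o ^ μ o * MvPowerSeries.X c ^ μ c := by
      conv_lhs => rw [finsupp_eq_single_add_single hoc hσ' μ]
      rw [MvPowerSeries.X_pow_eq, MvPowerSeries.X_pow_eq, MvPowerSeries.monomial_mul_monomial, one_mul]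
    have hGeq : (G : MvPowerSeries σ L) = MvPowerSeries.X o ^ μ o * W₀ ^ μ c * τ u + τ Pq := by
      rw [hGτ, hHμ, hmono, map_mul, map_mul, map_pow, map_pow, hτc, hτo]
    by_cases hμo : p ^ e ≤ μ o
    · exfalso
      refine hISO1 (MvPowerSeries.X o ^ (μ o - p ^ e) * W₀ ^ μ c * τ u) ?_
      rw [hGeq, ← mul_assoc, ← mul_assoc, ← pow_add, Nat.add_sub_cancel' hμo]
    by_cases hμc : p ^ e ≤ μ c
    · exfalso
      refine hISO2 (MvPowerSeries.X o ^ μ o * W₀ ^ (μ c - p ^ e) * τ u) ?_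
      rw [hGeq]
      conv_lhs => rw [← Nat.add_sub_cancel' hμc, pow_add]
      ring
    push Not at hμo hμc
    by_cases hμc0 : μ c = 0
    · -- `H = X_o^{μ_o}·u` with `q ∤ μ_o`: a monomial of degree `< q` in `G`
      exfalso
      have hμo' : ¬ p ^ e ∣ μ o := by
        intro hdvd
        apply hndvd
        intro i
        rcases hσ' i with rfl | rfl
        · exact hdvd
        · rw [hμc0]; exact dvd_zero _
      have hcoef : MvPowerSeries.coeff (Finsupp.single o (μ o)) (G : MvPowerSeries σ L) ≠ 0 := by
        rw [hGeq, hμc0, pow_zero, mul_one, map_add, MvPowerSeries.X_pow_eq, MvPowerSeries.coeff_monomial_mul,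
          if_pos le_rfl, tsub_self, one_mul, hτPq.coeff_eq_zero (d := Finsupp.single o (μ o)) (i := o)
            (by rw [Finsupp.single_eq_same]; exact hμo'), add_zero, MvPowerSeries.coeff_zero_eq_constantCoeff_apply,
          hτ0]
        exact hu
      rw [MvPolynomial.coeff_coe] at hcoef
      have h1 := hdeg _ (mem_support_iff.mpr hcoef)
      rw [Finsupp.degree_single] at h1
      omega
    · refine ⟨μ c, μ o, Nat.one_le_iff_ne_zero.mpr hμc0, hμc, W₀, τ u, τ Pq, hGeq, ?_, hW₀0, hW₀c, hτPq⟩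
      rw [hτ0]; exact hu
  · -- SMALL RESIDUAL CASE `H = X_y^{k q}·g`
    exfalso
    obtain ⟨k'', rfl⟩ := Nat.exists_eq_succ_of_ne_zero (Nat.pos_iff_ne_zero.mp hk')
    have hpow : MvPowerSeries.X y ^ ((k'' + 1) * p ^ e) = (MvPowerSeries.X y ^ p ^ e * MvPowerSeries.X y ^ (k'' * p ^ e) :
        MvPowerSeries σ L) := by
      rw [← pow_add]; congr 1; ring
    rcases hσ' y with rfl | rfl
    · refine hISO1 (MvPowerSeries.X (Φ.other) ^ (k'' * p ^ e) * τ g) ?_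
      rw [hGτ, hHy, map_mul, hpow, map_mul, map_pow, map_pow, hτo]
      ring
    · refine hISO2 (W₀ ^ (k'' * p ^ e) * τ g) ?_
      rw [hGτ, hHy, map_mul, hpow, map_mul, map_pow, map_pow, hτc]
      ring

end Start

section EndLaw

variable {σ : Type} [DecidableEq σ] [Fintype σ] {L : Type} [Field L] (p : ℕ) [Fact p.Prime] [CharP L p]

/-! ## §J THE TRAP ON THE WALK — `NoLowEmptyIsolatedSectionTailsDeep` PROVED; the node equation; `closes`

END LAW (a terminal END FORM after a move is either a fat point — ISO-1 — or an `h = 0` monomial flag, both excluded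
by the class binders (I)/(G)), the section's MOVE read as power series (tree `secState_step_F` + §F bridge), the
DESCENT on the MOVE CLOCK `b ↦ a + b − q < b` (strong induction), START at the terminal time `t₀ ≥ N`. -/

/-- **END LAW.** If the cleaned transform `F` (`↑F = clean(PT)`) comes from an END FORM `PT = X^β V + S_q` with
`β_x ≥ 1`, then either `q ∣ β` (and `X_x^q ∣` the principal part: a FAT point, ISO-1) or `F` is in the `h = 0`
MONOMIAL CASE for any `E ≠ ∅` — so an isolated, never-`h = 0`-terminal `F` is impossible. [new] [folklore] -/
theorem false_of_inEndForm (e : ℕ) {F : MvPolynomial σ L} {PT : MvPowerSeries σ L}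
    (hF : (F : MvPowerSeries σ L) = cleanSeries (p ^ e) PT) {β : σ →₀ ℕ} (hEnd : InEndForm (p ^ e) PT β)
    {x y : σ} (hyx : y ≠ x) (hβ : 1 ≤ β x) (hiso : IsolatedTop (p ^ e) F) {E : Finset σ} (hE : E ≠ ∅)
    (hnot : ¬ IsMonomialCase (p ^ e) E (F : MvPowerSeries σ L)) : False := by
  classical
  by_cases hdvd : ∀ l, p ^ e ∣ β l
  · obtain ⟨V, Q, hPT, hV, hQ⟩ := hEnd
    have hq : p ^ e ≤ β x := Nat.le_of_dvd hβ (hdvd x)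
    have hle : Finsupp.single x (p ^ e) ≤ β := Finsupp.single_le_iff.mpr hq
    have hmono : MvPowerSeries.monomial β (1 : L) =
        MvPowerSeries.X x ^ p ^ e * MvPowerSeries.monomial (β - Finsupp.single x (p ^ e)) 1 := by
      rw [MvPowerSeries.X_pow_eq, MvPowerSeries.monomial_mul_monomial, one_mul, add_tsub_cancel_of_le hle]
    refine not_isolatedTop_of_X_pow_form p e hyx
      (R := MvPowerSeries.monomial (β - Finsupp.single x (p ^ e)) 1 * V) (Q := Q - (PT - cleanSeries (p ^ e) PT))
      ?_ (hQ.sub (isQPow_sub_cleanSeries _ PT)) hiso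
    rw [hF]
    linear_combination hPT + V * hmono
  · apply hnot
    rw [hF]
    exact isMonomialCase_cleanSeries_of_inEndForm hEnd hdvd hE

end EndLaw

section Walk

variable {K : Type} [Field K] [DecidableEq K] {i j k : Fin 3}

/-- The two letters of `Fin 2`. [folklore] -/
theorem fin2_cover {x y : Fin 2} (hxy : x ≠ y) : ∀ l : Fin 2, l = x ∨ l = y := by
  revert x y; decide

/-- The tree's `step` stores the cleaned point transform. [folklore] -/
theorem step_F {σ : Type} [DecidableEq σ] {L : Type} [Field L] [DecidableEq L] (q : ℕ) (x : σ) (b : σ → L)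
    (s : State σ L) : (step q x b s).F = deletePthPowers q (pointTransform q x b s) := rfl

omit [DecidableEq K] in
/-- The section's translation vector vanishes at the section's chart letter. [folklore] -/
theorem secPt_idx_eq_zero (hij : i ≠ j) {l : Fin 3} (hl : l = i ∨ l = j) (b : Fin 3 → K) (hbl : b l = 0) :
    secPt i j b (idx i l) = 0 := by
  rcases hl with rfl | rfl
  · simp [secPt, idx, hbl]
  · simp [secPt, idx, hij.symm, hbl]

/-- After a planar move of order `> q` the section state has a NON-EMPTY exceptional-letter set (the chart letter
carries the new multiplicity `ord − q > 0`). [folklore] -/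
theorem excLetters_secState_succ_ne_empty (hij : i ≠ j) (hjk : j ≠ k) (hik : i ≠ k) {q : ℕ} {s₀ : State (Fin 3) K}
    (W : ForcedWalk q s₀) (t : ℕ) (hl : W.j t = i ∨ W.j t = j) (hord : ((q : ℕ) : ℕ∞) < ordZero (W.st t).F)
    (h0 : ∃ d ∈ (W.st t).F.support, d k = 0) : excLetters (secState i j k (W.st (t + 1))) ≠ ∅ := by
  classical
  rw [W.st_succ, ← excLetters_secState_step hij hjk hik q hl (W.b t) (W.st t) hord h0]
  have hsecne := secState_F_ne_zero hij hjk hik (s := W.st t) h0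
  obtain ⟨o', ho'⟩ := exists_ordZero_eq_natCast hsecne
  have hqo' : q < o' := by
    have := lt_of_lt_of_le hord (le_ordZero_secState hij hjk hik (W.st t))
    rw [ho'] at this
    exact_mod_cast this
  have h2 : (ordZero (secState i j k (W.st t)).F).toNat - q ≠ 0 := by rw [ho', ENat.toNat_coe]; omega
  intro hemp
  have hmem : idx i (W.j t) ∈
      excLetters (step q (idx i (W.j t)) (ι K ∘ secPt i j (W.b t)) (secState i j k (W.st t))) := by
    simp only [excLetters, Finsupp.mem_support_iff, step, newMult, Finsupp.coe_update, Function.update_self]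
    exact h2
  rw [hemp] at hmem
  exact Finset.notMem_empty _ hmem

end Walk

end Summit.ResolutionOfSingularities.ResolutionOfSingularities.Theorems.CurveTrap
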